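import Literature.NumberTheory.DiophantineGeometry.BelyiGaloisHurwitz
import Literature.NumberTheory.DiophantineGeometry.FunctionFieldEulerCharacteristicCover
import HarnessLib

/-!
# A Galois Belyi covering of hyperbolic signature `(p, q, r)` has genus at least `2`

Topic `NumberTheory/DiophantineGeometry`; theorems only (no definitions, no named facts). Companion
of `BelyiGaloisHurwitz.lean` (Riemann–Hurwitz for Galois Belyi functions over an algebraically
closed field of characteristic `0`).

This is the genus computation in the proof of Darmon–Granville's theorem on the generalised Fermat
equation `A x^p + B y^q = C z^r` (H. Darmon, A. Granville, Bull. LMS 27 (1995), §3, Prop. 3.1;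
E. Bombieri, W. Gubler, *Heights in Diophantine Geometry*, Prop. 12.6.9): a Galois covering
`X → ℙ¹` of signature `(p, q, r)` — unramified outside `{0, 1, ∞}`, ramification indices `p, q, r`
over `0, 1, ∞` — has genus `g` with `2g - 2 = d (1 - 1/p - 1/q - 1/r)`, hence `g ≥ 2` exactly in
the hyperbolic case `1/p + 1/q + 1/r < 1`, where Faltings' theorem applies.

* `IsBelyiFunction.finrank_mul_eq_of_isGalois_of_signature` — `d (1/p + 1/q + 1/r) = d + 2 - 2g`;
* `IsBelyiFunction.two_le_genus_of_isGalois_of_signature` — `qr + rp + pq < pqr ⇒ 2 ≤ g`.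

The EXISTENCE of such a covering over a number field (Riemann's existence theorem + descent,
Darmon–Granville Prop. 3.1, Bombieri–Gubler Cor. 12.6.7 and 12.6.8) is not in the tree; nor is the
invariance of the genus under constant field extension from a number field to `ℚ̄` for these
function fields (the tree's `FunctionFieldConstantExtensionGenusProofs` treats finite constant
fields).

## References

* [DarmonGranville1995] H. Darmon, A. Granville, *On the equations `z^m = F(x,y)` and
  `Ax^p + By^q = Cz^r`*, Bull. London Math. Soc. 27 (1995), §3, p. 525, Prop. 3.1.
* [BombieriGubler2006] E. Bombieri, W. Gubler, *Heights in Diophantine Geometry*, CUP 2006,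
  Prop. 12.6.9 (and Thm. B.4.6, Hurwitz).
* [Stichtenoth2009] H. Stichtenoth, *Algebraic Function Fields and Codes*, GTM 254, Cor. 3.5.5,
  Cor. 3.7.2 (the Riemann–Hurwitz input, via `BelyiGaloisHurwitz.lean`).
-/

noncomputable section

open scoped IntermediateField

namespace Literature.NumberTheory.DiophantineGeometry.AlgFunctionField

universe u v

variable {K : Type u} {F : Type v} [Field K] [Field F] [Algebra K F] [IsAlgFunctionField K F]
  [IsAlgClosed K] [CharZero K]

/-- **Riemann–Hurwitz for a Galois Belyi function of signature `(p, q, r)`** (Darmon–Granville,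
§3, before Prop. 3.1: "`2g - 2 = d (1 - 1/p - 1/q - 1/r)`"; Bombieri–Gubler, proof of Prop. 12.6.9):
let `K` be algebraically closed of characteristic `0`, `F/K` a function field and `f ∈ F` a Belyi
function with `F/K(f)` Galois of degree `d`, such that every zero of `f` has order `p`, every zero of
`f - 1` has order `q` and every pole of `f` has order `r` (a Galois covering of `ℙ¹` of *signature
`(p, q, r)`* in the sense of Darmon–Granville, p. 525). Then `p, q, r ≥ 1` and
`d · (1/p + 1/q + 1/r) = d + 2 - 2g`. This is the tree's Riemann–Hurwitz relation
`IsBelyiFunction.exists_ramification_of_isGalois` with its constant ramification indices identified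
with `p, q, r` (each fibre is non-empty: a non-constant function has a zero and a pole,
`exists_ord_pos` / `exists_ord_neg`). [cite: DarmonGranville1995, §3, Prop. 3.1] -/
theorem IsBelyiFunction.finrank_mul_eq_of_isGalois_of_signature {f : F} (hf : IsBelyiFunction K f)
    [IsGalois K⟮f⟯ F] {p q r : ℕ}
    (h₀ : ∀ P : PlaceOver K F, 0 < P.ord f → P.ord f = p)
    (h₁ : ∀ P : PlaceOver K F, 0 < P.ord (f - 1) → P.ord (f - 1) = q)
    (hi : ∀ P : PlaceOver K F, P.ord f < 0 → P.ord f = -r) :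
    0 < p ∧ 0 < q ∧ 0 < r ∧
      (Module.finrank K⟮f⟯ F : ℚ) * (1 / p + 1 / q + 1 / r) =
        Module.finrank K⟮f⟯ F + 2 - 2 * genus K F := by
  haveI := isIntegrallyClosedIn_of_isAlgClosed (K := K) (F := F)
  have hrat : ∀ P : PlaceOver K F, P.IsRational := PlaceOver.isRational_of_isAlgClosed
  obtain ⟨e₀, e₁, ei, he₀, he₁, hei, H₀, H₁, Hi, -, -, -, hRH⟩ := hf.exists_ramification_of_isGalois
  have hy := hf.not_mem_range
  have hy1 : f - 1 ∉ Set.range (algebraMap K F) := by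
    rintro ⟨c, hc⟩
    exact hy ⟨c + 1, by rw [map_add, map_one, hc, sub_add_cancel]⟩
  obtain ⟨P₀, hP₀⟩ := exists_ord_pos hrat hy
  obtain ⟨P₁, hP₁⟩ := exists_ord_pos hrat hy1
  obtain ⟨Pi, hPi⟩ := exists_ord_neg hrat hy
  have hp : (p : ℤ) = e₀ := (h₀ P₀ hP₀).symm.trans (H₀ P₀ hP₀)
  have hq : (q : ℤ) = e₁ := (h₁ P₁ hP₁).symm.trans (H₁ P₁ hP₁)
  have hr : (r : ℤ) = ei := by have := (hi Pi hPi).symm.trans (Hi Pi hPi); omega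
  obtain rfl : p = e₀ := by exact_mod_cast hp
  obtain rfl : q = e₁ := by exact_mod_cast hq
  obtain rfl : r = ei := by exact_mod_cast hr
  exact ⟨he₀, he₁, hei, hRH⟩

/-- **A Galois covering of `ℙ¹` of hyperbolic signature `(p, q, r)` has genus `≥ 2`**
(Bombieri–Gubler, Prop. 12.6.9: "The genus of `C` satisfies `g(C) ≥ 2`", for the Galois covering
`π : C → ℙ¹` unramified outside `{0, 1, ∞}` with ramification indices `p, q, r` and
`1/p + 1/q + 1/r < 1`; Darmon–Granville, Prop. 3.1: "If `χ(p,q,r) < 0`, then `g > 1`"). In the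
function-field language of the tree, over an algebraically closed field `K` of characteristic `0`
(B–G work "over the complex numbers", the genus being invariant under base extension): if `f` is a
Belyi function of `F/K` with `F/K(f)` Galois whose zeros, zeros of `f - 1` and poles have orders
`p`, `q`, `r` respectively, and `qr + rp + pq < pqr` (i.e. `1/p + 1/q + 1/r < 1`, the hypothesis of
`Literature.NumberTheory.DiophantineGeometry.darmonGranville1995_thm_2`), then `genus F/K ≥ 2`.
From `finrank_mul_eq_of_isGalois_of_signature`: `d + 2 - 2g = d (1/p + 1/q + 1/r) < d`.
[cite: BombieriGubler2006, Prop. 12.6.9] -/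
theorem IsBelyiFunction.two_le_genus_of_isGalois_of_signature {f : F} (hf : IsBelyiFunction K f)
    [IsGalois K⟮f⟯ F] {p q r : ℕ}
    (h₀ : ∀ P : PlaceOver K F, 0 < P.ord f → P.ord f = p)
    (h₁ : ∀ P : PlaceOver K F, 0 < P.ord (f - 1) → P.ord (f - 1) = q)
    (hi : ∀ P : PlaceOver K F, P.ord f < 0 → P.ord f = -r)
    (hpqr : q * r + r * p + p * q < p * q * r) :
    2 ≤ genus K F := by
  obtain ⟨hp, hq, hr, hRH⟩ := hf.finrank_mul_eq_of_isGalois_of_signature h₀ h₁ hi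
  haveI := isIntegrallyClosedIn_of_isAlgClosed (K := K) (F := F)
  haveI := IsAlgFunctionField.finiteDimensional_adjoin_simple
    (transcendental_of_not_mem_range hf.not_mem_range)
  have hd : (0 : ℚ) < Module.finrank K⟮f⟯ F := by exact_mod_cast Module.finrank_pos
  have hsum : (1 : ℚ) / p + 1 / q + 1 / r < 1 := by
    have hp' : (0 : ℚ) < p := by exact_mod_cast hp
    have hq' : (0 : ℚ) < q := by exact_mod_cast hq
    have hr' : (0 : ℚ) < r := by exact_mod_cast hr
    have hcast : (q * r + r * p + p * q : ℚ) < p * q * r := by exact_mod_cast hpqr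
    rw [div_add_div _ _ hp'.ne' hq'.ne', div_add_div _ _ (mul_pos hp' hq').ne' hr'.ne',
      div_lt_one (by positivity)]
    linarith
  have : (Module.finrank K⟮f⟯ F : ℚ) * (1 / p + 1 / q + 1 / r) < Module.finrank K⟮f⟯ F := by
    nlinarith
  rw [hRH] at this
  have h2 : (1 : ℚ) < genus K F := by linarith
  have h3 : 1 < genus K F := by exact_mod_cast h2
  omega

end Literature.NumberTheory.DiophantineGeometry.AlgFunctionField
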